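import Mathlib
import Literature.Computability.AlgebraicComplexity.ArithCircuitProofs
import HarnessLib

/-!
# Nonscalar computation sequences (Ostrowski's measure) and their closure properties

Topic `Literature/Computability/AlgebraicComplexity`. Support file for the formalisation of
R. Andrews, *On Matrix Multiplication and Polynomial Identity Testing* (FOCS 2022,
arXiv:2208.01078), Theorem 3 (`DeterminantalIdealComplexity.lean`, fact `Andrews2022_thm3`), whose
proof counts MULTIPLICATION GATES only (Andrews, Def. 1: "The multiplicative complexity of a circuit
is the number of multiplication gates"). The classical device for this count is Ostrowski's
nonscalar model (Bürgisser–Clausen–Shokrollahi 1997, Ch. 4, Def. (4.2) and §4.1: a computation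
sequence in which `K`-linear combinations of inputs, constants and earlier results are free and only
the products `g_k = u_k · v_k` of two such combinations are counted).

## Content

* `freeSpan S` — the `R`-submodule `R·1 + Σᵢ R·Xᵢ + Σ_{s ∈ S} R·s` of `R[X_σ]` of polynomials that
  cost nothing once the polynomials in `S` have been computed (BCS 1997, §4.1).
* `IsNonscalarSeq gs` — `gs = [g_s, …, g_1]` (newest first) is a nonscalar computation sequence:
  every `g_k` is a product `u_k · v_k` with `u_k, v_k ∈ freeSpan {g_1, …, g_{k-1}}`
  (BCS 1997, Def. (4.2) with the cost function `c_*` of (4.6): nonscalar multiplications cost `1`).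
* `ArithCircuit.exists_isNonscalarSeq` — a fan-in-two `ArithCircuit` (the tree's circuit model,
  `ArithCircuit.lean`) of size `s` yields a nonscalar computation sequence of length `≤ s` whose free
  span contains the computed polynomial: the number of nonscalar multiplications is at most the
  number of product gates, hence at most the size (Andrews 2022, Def. 1; BCS 1997, (4.7)).
* Closure properties used by the Baur–Strassen argument and by Andrews' reductions: extension of
  scalars along a ring hom (`IsNonscalarSeq.map`), and substitution of cost-free polynomials for the
  variables followed by concatenation with an already computed prefix
  (`IsNonscalarSeq.aeval_append`; BCS 1997, §4.1, Rem. (4.3)(3)).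

## Design notes

* Lists are NEWEST FIRST so that the defining recursion is structural; the oldest element of
  `gs ++ [g]` is `g`, a product of two affine-linear forms (`IsNonscalarSeq.of_append`).
* No base field is needed: everything is stated over a commutative semiring `R`.
* Nothing here is specific to Andrews' paper; no named facts are introduced (D-0026).

## References

* [BurgisserClausenShokrollahi1997] P. Bürgisser, M. Clausen, M. A. Shokrollahi, *Algebraic Complexity Theory*,
  Springer 1997, Ch. 4, Def. (4.2), Rem. (4.3), (4.6)–(4.7), §4.1 (Ostrowski's model).
* [Andrews2022] R. Andrews, *On Matrix Multiplication and Polynomial Identity Testing*, FOCS 2022,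
  arXiv:2208.01078, Def. 1.
* [Burgisser2000] P. Bürgisser, *Completeness and Reduction in Algebraic Complexity Theory*, 2000,
  Def. 2.1 (the circuit model of `ArithCircuit`).
-/

noncomputable section

open MvPolynomial

namespace Literature.Computability.AlgebraicComplexity

universe u v w u'

section FreeSpan

variable {R : Type u} [CommSemiring R] {σ : Type v} {τ : Type w}

/-- The **cost-free span** of a set `S` of already computed polynomials in Ostrowski's nonscalar
model: the `R`-submodule of `R[X_σ]` spanned by `1`, the variables `X i` and the elements of `S`
(BCS 1997, §4.1: linear operations and constants are free). [cite: BurgisserClausenShokrollahi1997, §4.1] -/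
def freeSpan (S : Set (MvPolynomial σ R)) : Submodule R (MvPolynomial σ R) :=
  Submodule.span R (insert 1 (Set.range X ∪ S))

/-- `freeSpan` is monotone. [cite: BurgisserClausenShokrollahi1997, §4.1] -/
theorem freeSpan_mono {S T : Set (MvPolynomial σ R)} (h : S ⊆ T) : freeSpan S ≤ freeSpan T :=
  Submodule.span_mono (Set.insert_subset_insert (Set.union_subset_union_right _ h))

/-- `1` is free. [cite: BurgisserClausenShokrollahi1997, §4.1] -/
theorem one_mem_freeSpan (S : Set (MvPolynomial σ R)) : (1 : MvPolynomial σ R) ∈ freeSpan S :=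
  Submodule.subset_span (Set.mem_insert _ _)

/-- Variables are free. [cite: BurgisserClausenShokrollahi1997, §4.1] -/
theorem X_mem_freeSpan (S : Set (MvPolynomial σ R)) (i : σ) :
    (X i : MvPolynomial σ R) ∈ freeSpan S :=
  Submodule.subset_span (Set.mem_insert_of_mem _ (Set.mem_union_left _ ⟨i, rfl⟩))

/-- Already computed polynomials are free. [cite: BurgisserClausenShokrollahi1997, §4.1] -/
theorem mem_freeSpan_of_mem {S : Set (MvPolynomial σ R)} {p : MvPolynomial σ R} (h : p ∈ S) :
    p ∈ freeSpan S :=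
  Submodule.subset_span (Set.mem_insert_of_mem _ (Set.mem_union_right _ h))

/-- Constants are free. [cite: BurgisserClausenShokrollahi1997, §4.1] -/
theorem C_mem_freeSpan (S : Set (MvPolynomial σ R)) (c : R) :
    (C c : MvPolynomial σ R) ∈ freeSpan S := by
  rw [← mul_one (C c), ← smul_eq_C_mul]
  exact Submodule.smul_mem _ c (one_mem_freeSpan S)

/-- Induction principle: an `R`-linear map sends `freeSpan S` into a submodule `M` as soon as it
sends `1`, the variables and `S` into `M`. [cite: BurgisserClausenShokrollahi1997, §4.1] -/
theorem freeSpan_le_comap {N : Type u'} [AddCommMonoid N] [Module R N]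
    (f : MvPolynomial σ R →ₗ[R] N) {S : Set (MvPolynomial σ R)} {M : Submodule R N}
    (h1 : f 1 ∈ M) (hX : ∀ i, f (X i) ∈ M) (hS : ∀ s ∈ S, f s ∈ M) :
    freeSpan S ≤ M.comap f := by
  rw [freeSpan, Submodule.span_le]
  rintro x (rfl | ⟨i, rfl⟩ | hx)
  · exact h1
  · exact hX i
  · exact hS x hx

/-- Pointwise form of `freeSpan_le_comap`. [cite: BurgisserClausenShokrollahi1997, §4.1] -/
theorem apply_mem_of_mem_freeSpan {N : Type u'} [AddCommMonoid N] [Module R N]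
    (f : MvPolynomial σ R →ₗ[R] N) {S : Set (MvPolynomial σ R)} {M : Submodule R N}
    (h1 : f 1 ∈ M) (hX : ∀ i, f (X i) ∈ M) (hS : ∀ s ∈ S, f s ∈ M) {p : MvPolynomial σ R}
    (hp : p ∈ freeSpan S) : f p ∈ M :=
  freeSpan_le_comap f h1 hX hS hp

/-- The set of members of a mapped list. [folklore] -/
theorem setOf_mem_map {α : Type u'} {β : Type w} (f : α → β) (l : List α) :
    {y | y ∈ l.map f} = f '' {x | x ∈ l} := by
  ext y
  simp only [Set.mem_setOf_eq, List.mem_map, Set.mem_image]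

/-- Extension of scalars along a ring hom maps cost-free polynomials to cost-free polynomials
(BCS 1997, §4.1). [cite: BurgisserClausenShokrollahi1997, §4.1] -/
theorem map_mem_freeSpan {S : Type u'} [CommSemiring S] (φ : R →+* S)
    {T : Set (MvPolynomial σ R)} {p : MvPolynomial σ R} (hp : p ∈ freeSpan T) :
    MvPolynomial.map φ p ∈ freeSpan (MvPolynomial.map φ '' T) := by
  induction hp using Submodule.span_induction with
  | mem x hx =>
    rcases hx with rfl | ⟨i, rfl⟩ | hx
    · simpa only [map_one] using one_mem_freeSpan _
    · simpa only [map_X] using X_mem_freeSpan _ i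
    · exact mem_freeSpan_of_mem ⟨x, hx, rfl⟩
  | zero => simp
  | add x y _ _ hx hy => simpa only [map_add] using add_mem hx hy
  | smul a x _ hx =>
    rw [smul_eq_C_mul, map_mul, map_C, ← smul_eq_C_mul]
    exact Submodule.smul_mem _ _ hx

end FreeSpan

section NonscalarSeq

variable {R : Type u} [CommSemiring R] {σ : Type v} {τ : Type w}

/-- **Nonscalar computation sequences** (newest first): `[]` is one, and `g :: gs` is one if `gs`
is and `g = u · v` for some `u, v` in the cost-free span of the earlier results `gs`. Its length is
the number of nonscalar multiplications (BCS 1997, Def. (4.2) with the cost function `c_*` of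
(4.6); Andrews 2022, Def. 1, "multiplicative complexity"). [cite: BurgisserClausenShokrollahi1997, Def. (4.2) and (4.6)] -/
def IsNonscalarSeq : List (MvPolynomial σ R) → Prop
  | [] => True
  | g :: gs => IsNonscalarSeq gs ∧
      ∃ u ∈ freeSpan {x | x ∈ gs}, ∃ v ∈ freeSpan {x | x ∈ gs}, g = u * v

/-- The empty sequence. [cite: BurgisserClausenShokrollahi1997, Def. (4.2)] -/
@[simp] theorem isNonscalarSeq_nil : IsNonscalarSeq ([] : List (MvPolynomial σ R)) := trivial

/-- Unfolding a nonempty sequence. [cite: BurgisserClausenShokrollahi1997, Def. (4.2)] -/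
theorem isNonscalarSeq_cons {g : MvPolynomial σ R} {gs : List (MvPolynomial σ R)} :
    IsNonscalarSeq (g :: gs) ↔ IsNonscalarSeq gs ∧
      ∃ u ∈ freeSpan {x | x ∈ gs}, ∃ v ∈ freeSpan {x | x ∈ gs}, g = u * v :=
  Iff.rfl

/-- A suffix (= the older part) of a computation sequence is a computation sequence.
[cite: BurgisserClausenShokrollahi1997, Def. (4.2)] -/
theorem IsNonscalarSeq.of_append {gs hs : List (MvPolynomial σ R)}
    (h : IsNonscalarSeq (gs ++ hs)) : IsNonscalarSeq hs := by
  induction gs with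
  | nil => simpa using h
  | cons g gs ih => exact ih h.1

/-- The oldest element of a computation sequence is a product of two affine-linear forms
(elements of `freeSpan ∅`). [cite: BurgisserClausenShokrollahi1997, Def. (4.2)] -/
theorem IsNonscalarSeq.oldest {gs : List (MvPolynomial σ R)} {g : MvPolynomial σ R}
    (h : IsNonscalarSeq (gs ++ [g])) :
    ∃ u ∈ freeSpan (∅ : Set (MvPolynomial σ R)), ∃ v ∈ freeSpan (∅ : Set (MvPolynomial σ R)),
      g = u * v := by
  have h1 : IsNonscalarSeq [g] := h.of_append
  have he : {x : MvPolynomial σ R | x ∈ ([] : List (MvPolynomial σ R))} = ∅ := by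
    ext x
    simp
  simpa [isNonscalarSeq_cons, he] using h1

/-- **Extension of scalars**: mapping every member of a computation sequence along a ring hom
`φ : R →+* S` gives a computation sequence over `S` (BCS 1997, §4.1). [cite: BurgisserClausenShokrollahi1997, §4.1] -/
theorem IsNonscalarSeq.map {S : Type u'} [CommSemiring S] (φ : R →+* S)
    {gs : List (MvPolynomial σ R)} (h : IsNonscalarSeq gs) :
    IsNonscalarSeq (gs.map (MvPolynomial.map φ)) := by
  induction gs with
  | nil => simp
  | cons g gs ih =>
    obtain ⟨hgs, u, hu, v, hv, rfl⟩ := h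
    refine ⟨ih hgs, MvPolynomial.map φ u, ?_, MvPolynomial.map φ v, ?_, by simp⟩
    · rw [setOf_mem_map]
      exact map_mem_freeSpan φ hu
    · rw [setOf_mem_map]
      exact map_mem_freeSpan φ hv

/-- Membership in the free span is preserved by extension of scalars, in the form used with
`IsNonscalarSeq.map`. [cite: BurgisserClausenShokrollahi1997, §4.1] -/
theorem map_mem_freeSpan_map {S : Type u'} [CommSemiring S] (φ : R →+* S)
    {gs : List (MvPolynomial σ R)} {p : MvPolynomial σ R} (hp : p ∈ freeSpan {x | x ∈ gs}) :
    MvPolynomial.map φ p ∈ freeSpan {x | x ∈ gs.map (MvPolynomial.map φ)} := by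
  rw [setOf_mem_map]
  exact map_mem_freeSpan φ hp

/-- **Substitution and concatenation** (BCS 1997, §4.1, Rem. (4.3)): let `hs` be a computation
sequence in `R[X_τ]` and `θ : σ → R[X_τ]` a substitution by polynomials that are cost-free given
`hs`. Then substituting `θ` into a computation sequence `gs` in `R[X_σ]` and appending `hs` gives a
computation sequence, and `θ` maps the cost-free span of `gs` into the cost-free span of the
result. (With `hs = []`: substitution of affine-linear forms is free.) [cite: BurgisserClausenShokrollahi1997, §4.1, Rem. (4.3)] -/
theorem IsNonscalarSeq.aeval_append {θ : σ → MvPolynomial τ R} {hs : List (MvPolynomial τ R)}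
    (hθ : ∀ i, θ i ∈ freeSpan {x | x ∈ hs}) (hhs : IsNonscalarSeq hs)
    {gs : List (MvPolynomial σ R)} (hgs : IsNonscalarSeq gs) :
    IsNonscalarSeq (gs.map (aeval θ) ++ hs) ∧
      ∀ p ∈ freeSpan {x | x ∈ gs},
        aeval θ p ∈ freeSpan {x | x ∈ gs.map (aeval θ) ++ hs} := by
  induction gs with
  | nil =>
    refine ⟨by simpa using hhs, fun p hp => ?_⟩
    refine apply_mem_of_mem_freeSpan (aeval θ).toLinearMap ?_ ?_ ?_ hp
    · simpa using one_mem_freeSpan _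
    · intro i
      simpa using hθ i
    · intro s hs'
      simp at hs'
  | cons g gs ih =>
    obtain ⟨hgs', u, hu, v, hv, rfl⟩ := hgs
    obtain ⟨ih1, ih2⟩ := ih hgs'
    have hmono : freeSpan {x | x ∈ gs.map (aeval θ) ++ hs} ≤
        freeSpan {x | x ∈ (u * v :: gs).map (aeval θ) ++ hs} :=
      freeSpan_mono fun x hx => by
        simp only [List.map_cons, List.cons_append, Set.mem_setOf_eq, List.mem_cons]
        exact Or.inr hx
    refine ⟨⟨ih1, aeval θ u, ih2 u hu, aeval θ v, ih2 v hv, by simp⟩, fun p hp => ?_⟩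
    refine apply_mem_of_mem_freeSpan (aeval θ).toLinearMap ?_ ?_ ?_ hp
    · simpa using one_mem_freeSpan _
    · intro i
      exact hmono (by simpa using (freeSpan_mono (fun x hx => by simp_all)) (hθ i))
    · intro s hs'
      simp only [Set.mem_setOf_eq, List.mem_cons] at hs'
      rcases hs' with rfl | hs'
      · exact mem_freeSpan_of_mem (by simp)
      · exact hmono (ih2 _ (mem_freeSpan_of_mem hs'))

end NonscalarSeq

/-! ### From fan-in-two circuits to nonscalar computation sequences -/

namespace ArithCircuit

variable {k : Type u} [CommSemiring k] {σ : Type v}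

/-- The value of an operand is cost-free given the values computed so far.
[cite: BurgisserClausenShokrollahi1997, §4.1] -/
theorem Operand.eval_mem_freeSpan {vals : List (MvPolynomial σ k)} {S : Set (MvPolynomial σ k)}
    (h : ∀ v ∈ vals, v ∈ freeSpan S) (u : Operand k σ) : u.eval vals ∈ freeSpan S := by
  cases u with
  | var i => exact X_mem_freeSpan S i
  | const c => exact C_mem_freeSpan S c
  | gate j =>
    rw [Operand.eval_gate, List.getD_eq_getElem?_getD]
    cases hj : vals[j]? with
    | none => simp
    | some v => simpa using h v (List.mem_of_getElem? hj)

/-- Gate-list form of `exists_isNonscalarSeq`: the values of a list of fan-in-two gates are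
cost-free given a nonscalar computation sequence with at most one product per gate.
[cite: BurgisserClausenShokrollahi1997, (4.7)] -/
theorem exists_isNonscalarSeq_gateValues (gates : List (Gate k σ))
    (hfan : ∀ g ∈ gates, g.fanIn ≤ 2) :
    ∃ gs : List (MvPolynomial σ k), IsNonscalarSeq gs ∧ gs.length ≤ gates.length ∧
      ∀ v ∈ gateValues gates, v ∈ freeSpan {x | x ∈ gs} := by
  induction gates using List.reverseRecOn with
  | nil => exact ⟨[], isNonscalarSeq_nil, le_rfl, by simp [gateValues]⟩
  | append_singleton gates g ih =>
    obtain ⟨gs, hgs, hlen, hvals⟩ := ih fun g' hg' => hfan g' (List.mem_append_left _ hg')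
    have hg2 : g.fanIn ≤ 2 := hfan g (by simp)
    have hop : ∀ u : Operand k σ, u.eval (gateValues gates) ∈ freeSpan {x | x ∈ gs} :=
      fun u => Operand.eval_mem_freeSpan hvals u
    rw [gateValues_append_singleton]
    cases g with
    | sum args =>
      refine ⟨gs, hgs, hlen.trans (by simp), fun v hv => ?_⟩
      rw [List.mem_append, List.mem_singleton] at hv
      rcases hv with hv | rfl
      · exact hvals v hv
      · exact list_sum_mem fun x hx => by
          rw [List.mem_map] at hx
          obtain ⟨a, -, rfl⟩ := hx
          exact Submodule.smul_mem _ _ (hop a.2)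
    | prod args =>
      have hlen' : gs.length ≤ (gates ++ [Gate.prod args]).length := hlen.trans (by simp)
      match args, hg2 with
      | [], _ =>
        refine ⟨gs, hgs, hlen', fun v hv => ?_⟩
        rw [List.mem_append, List.mem_singleton] at hv
        rcases hv with hv | rfl
        · exact hvals v hv
        · simpa [Gate.eval] using one_mem_freeSpan _
      | [u], _ =>
        refine ⟨gs, hgs, hlen', fun v hv => ?_⟩
        rw [List.mem_append, List.mem_singleton] at hv
        rcases hv with hv | rfl
        · exact hvals v hv
        · simpa [Gate.eval] using hop u
      | [u, w], _ =>
        refine ⟨(u.eval (gateValues gates) * w.eval (gateValues gates)) :: gs,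
          ⟨hgs, _, hop u, _, hop w, rfl⟩, by simpa using hlen, fun v hv => ?_⟩
        have hmono : freeSpan {x | x ∈ gs} ≤
            freeSpan {x | x ∈ (u.eval (gateValues gates) * w.eval (gateValues gates)) :: gs} :=
          freeSpan_mono fun x hx => by
            simp only [Set.mem_setOf_eq, List.mem_cons]
            exact Or.inr hx
        rw [List.mem_append, List.mem_singleton] at hv
        rcases hv with hv | rfl
        · exact hmono (hvals v hv)
        · simpa [Gate.eval] using
            (mem_freeSpan_of_mem (by simp) :
              u.eval (gateValues gates) * w.eval (gateValues gates) ∈ freeSpan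
                {x | x ∈ (u.eval (gateValues gates) * w.eval (gateValues gates)) :: gs})
      | _ :: _ :: _ :: _, h => simp [Gate.fanIn, Gate.args] at h

/-- **Circuits have at least as many gates as nonscalar multiplications**: a fan-in-two arithmetic
circuit of size `s` (the tree's `ArithCircuit`, Bürgisser 2000, Def. 2.1) yields a nonscalar
computation sequence of length `≤ s` (one product `u · v` per product gate with two operands; sum
gates, and product gates with `≤ 1` operand, are free) whose cost-free span contains the computed
polynomial (Andrews 2022, Def. 1; BCS 1997, (4.7): `L^{ns} ≤ L^{tot}`). [cite: BurgisserClausenShokrollahi1997, (4.7)] -/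
theorem exists_isNonscalarSeq (P : ArithCircuit k σ) (hP : P.IsFanInTwo) :
    ∃ gs : List (MvPolynomial σ k), IsNonscalarSeq gs ∧ gs.length ≤ P.size ∧
      P.eval ∈ freeSpan {x | x ∈ gs} := by
  obtain ⟨gs, hgs, hlen, hvals⟩ := exists_isNonscalarSeq_gateValues P.gates hP
  exact ⟨gs, hgs, hlen, Operand.eval_mem_freeSpan hvals P.output⟩

end ArithCircuit

/-- **Nonscalar cost is at most the circuit complexity**: every polynomial `f` admits a nonscalar
computation sequence of length `≤ complexity f` whose cost-free span contains `f`
(`complexity` = least size of a fan-in-two circuit computing `f`, attained by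
`ArithCircuit.exists_computes_size_eq_complexity`). [cite: BurgisserClausenShokrollahi1997, (4.7)] -/
theorem exists_isNonscalarSeq_length_le_complexity {k : Type u} [CommSemiring k] {σ : Type v}
    (f : MvPolynomial σ k) :
    ∃ gs : List (MvPolynomial σ k), IsNonscalarSeq gs ∧ gs.length ≤ complexity f ∧
      f ∈ freeSpan {x | x ∈ gs} := by
  obtain ⟨P, h2, hf, hsize⟩ := ArithCircuit.exists_computes_size_eq_complexity f
  obtain ⟨gs, hgs, hlen, hmem⟩ := P.exists_isNonscalarSeq h2
  refine ⟨gs, hgs, hsize ▸ hlen, ?_⟩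
  rw [ArithCircuit.Computes] at hf
  exact hf ▸ hmem

end Literature.Computability.AlgebraicComplexity
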